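import Literature.Analysis.FluidPDE.FirstIntegralTransportDefect
import Mathlib.Analysis.Calculus.Deriv.Mul
import Mathlib.Analysis.Calculus.FDeriv.Symmetric
import Mathlib.Analysis.InnerProductSpace.Laplacian
import HarnessLib

/-!
# Ohkitani's identity `D(Sω)/Dt = −Pω` and the tilting budget `D(ω × Sω)/Dt = −ω × Pω`
# (Galanti–Gibbon–Heritage 1997, §2 (sigderiv), (conv2)), pointwise, Euler and Navier–Stokes

Analysis/FluidPDE proof file (theorems only; no definitions, no named facts), companion of
`VorticityDirectionDynamics.lean` (the `|ω|`/`ξ` dynamics (Dw4)/(Dξ/Dt,2)) and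
`BurgersVortexTiltingFree.lean` (the exactly aligned example of §4).

## What is printed

B. Galanti, J. D. Gibbon, M. Heritage, *Vorticity alignment results for the three-dimensional Euler
and Navier–Stokes equations*, Nonlinearity 10 (1997) 1675–1694 = arXiv:chao-dyn/9709003
(render `paper-arxiv-chao-dyn_9709003`), §1 p. 3 and §2 p. 5, verbatim:

> In order to find the most sensitive relationship between `α` and `χ` we take advantage in §2 of a
> result of Ohkitani [Ohk1, Ohk2] for the incompressible three-dimensional Euler equations
> `Dσ/Dt = −Pσ…` ((sigderiv): **`Dσ/Dt = −Pω`**, `σ = Sω`), where `P = {p,ᵢⱼ}` is the Hessian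
> matrix of the pressure. This result [Note added in proof: … P. Constantin has informed us that the
> result in equation (10) has been known privately in unpublished form since 1983] comes about from
> a more general well known property of the Euler equations, namely that if `u` and `ω` are velocity
> and vorticity solutions of the Euler equations then for any arbitrary vector `A`,
> `D/Dt(ω·∇A) = ω·∇(DA/Dt)` ((Aequn2)). Choosing `A = u` with a direct use of the velocity form
> of the Euler equations … immediately gives equation (sigderiv) … the cancellation of two terms
> inherent in the derivation …, each of which are `∼ ω|∇u|²`, directly removes all the terms not
> explicitly dependent on `P`.

> (§2) … whereas in the cross product, the terms in `σ` vanish leaving only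
> ((conv2)) **`D(ω × σ)/Dt = −ω × Pω`** … On the `α`-axis where `φ = 0` or `π`, equation (conv2)
> show[s] that `ω × Pω = 0`.

and §6 p. 11: "when `ω` aligns with an eigenvector of `S` then `ω` also aligns simultaneously with
an eigenvector of `P`". For Navier–Stokes, §3 works with
`DS/Dt = −S² + (|ω|²δ − ω⊗ω)/4 − P + νΔS` ((strain,deriv2), p. 7:
`DS_ij/Dt = −S_ikS_kj − ω_iω_j/4 + |ω|²δ_ij/4 − P_ij + νΔS_ij`) and `Dω/Dt = Sω + νΔω`, whence
`Dσ/Dt = −Pω + ν(ΔS ω + S Δω)` (the `S²ω` terms cancel as in the Euler case).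

## What is here (pointwise at `(t, x)`, in the frame of the tree's classical vorticity equation)

Throughout `σ(s, y) = ∇u(s, y) ω(s, y)` is written with the FULL velocity gradient
`fderiv ℝ (u s) y (curl (u s) y)` (`= Sω` since the antisymmetric part of `∇u` acts on `ω` as
`½ ω × ω = 0`; this is the stretching term `convect (curl u) u` of the tree's vorticity equation),
`P ω = fderiv ℝ (gradient (p t)) x ω` is the pressure Hessian applied to `ω`, and `D/Dt` is
unfolded as `∂ₜ + (u·∇)`, the convective part being `fderiv ℝ (·) x (u t x)` of the spatial field.
Hypotheses: `uncurry u` is `C²` at `(t, x)` (mixed partials commute: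
`hasDerivAt_fderiv_slice_of_contDiffAt`), the momentum equation
`∂ₜu = νΔu − (u·∇)u − ∇p` holds on a spatial neighbourhood of `x` at time `t` (so that it may be
differentiated once in space), the classical vorticity equation
`∂ₜω = νΔω − (u·∇)ω + (ω·∇)u` holds at `(t, x)` (the shape delivered by
`IsLerayHopfOn.vorticity_classical_of_contDiffOn`), and `Δu(t,·)`, `∇p(t,·)` are differentiable at
`x` (automatic for smooth solutions; needed to split the spatial derivative of the momentum
equation into its three terms).

* `fderiv_stretching_apply` — the kinematic expansion
  `∇σ h = (∇²u h) ω + ∇u (∇ω h)` and `convect_stretching_eq` — `(u·∇)σ = ∇²u(u, ω) + ∇u((u·∇)ω)`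
  with the symmetric second derivative (Schwarz);
* **`hasDerivAt_stretching`** — GGH (sigderiv) with the Navier–Stokes viscous terms:
  `∂ₜσ = ν(∇(Δu) ω + ∇u Δω) − (u·∇)σ − Pω`, i.e. **`Dσ/Dt = −Pω + ν(∇Δu ω + ∇u Δω)`**
  (`= −Pω + ν(ΔS ω + SΔω)` of §3, the antisymmetric parts cancelling in the sum); the two
  `∼ ω|∇u|²` terms `∇u(∇u ω)` cancel exactly as printed, and `∇²u(ω, u) = ∇²u(u, ω)` is the
  symmetry of second derivatives;
* **`hasDerivAt_stretching_euler`** — `ν = 0`: **`Dσ/Dt = −Pω`** (Ohkitani; GGH (sigderiv));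
* **`hasDerivAt_cross_stretching`** — GGH (conv2) with viscosity:
  `D(ω × σ)/Dt = −ω × Pω + ν(Δω × σ + ω × (∇Δu ω + ∇u Δω))`, and
  **`hasDerivAt_cross_stretching_euler`** — `ν = 0`: **`D(ω × σ)/Dt = −ω × Pω`**;
* **`cross_pressureHessian_eq_of_tiltingFree`** — the `α`-axis remark / "double alignment": if the
  tilting vector `ω × σ` vanishes on a space–time neighbourhood of `(t, x)`, then at `(t, x)`
  `ω × Pω = ν(Δω × σ + ω × (∇Δu ω + ∇u Δω))`; for Euler (`cross_pressureHessian_eq_zero_of_tiltingFree_euler`)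
  **`ω × Pω = 0`** — a persistently aligned vorticity is simultaneously an eigenvector of the
  pressure Hessian.

Deviations (docstring level): (i) GGH's `S` (strain) is replaced by the full gradient `∇u` acting
on `ω` — the same vector `σ`; in the viscous term this turns `ΔSω + SΔω` into `∇Δu ω + ∇uΔω`
(equal, see above); (ii) the identities are stated at one point under pointwise hypotheses rather
than for a global smooth solution; (iii) unforced, as printed. WHAT THIS IS NOT: no regularity
statement and no claim about alignment statistics — exact pointwise identities for classical
solutions (the kinematic side of nsreg-p1's S19 «double alignment» lever (A)(iii)).

## Tree / Mathlib search

Tree (used): `curl`, `cross`, `crossCLM`, `hasFDerivAt_cross`, `convect`/`convect_apply`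
(`VectorCalculus`), `hasDerivAt_fderiv_slice_of_contDiffAt` (`FirstIntegralTransportDefect`, mixed
partials), the vorticity-equation shape of `IsLerayHopfOn.vorticity_classical_of_contDiffOn`.
Mathlib: `HasDerivAt.clm_apply`, `fderiv_clm_apply`, `ContinuousLinearMap.hasDerivAt_of_bilinear`,
`ContDiffAt.isSymmSndFDerivAt`, `Filter.EventuallyEq.fderiv_eq`, `Filter.EventuallyEq.deriv_eq`.
Searched (`lean search`/`rg`): `pressureHessian`, `Ohkitani`, `stretching.*HasDerivAt`,
`sigderiv` — the tree has the strain/pressure-Hessian TRACE identities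
(`MillerEnstrophyProductionIdentity`, `TorusEnstrophyStrainIdentity`) and the restricted-Euler
gradient dynamics, but not the pointwise `D(Sω)/Dt` identity.

## References

* B. Galanti, J. D. Gibbon, M. Heritage, Nonlinearity 10 (1997) 1675–1694 =
  arXiv:chao-dyn/9709003, §1 (sigderiv), (Aequn), (Aequn2); §2 (conv1), (conv2), remark after
  (chipdef); §3 first displays; §6 p. 11. [`GalantiGibbonHeritage1997`]
* K. Ohkitani, *Eigenvalue problems in three-dimensional Euler flows*, Phys. Fluids A 5 (1993)
  2570–2572; K. Ohkitani, S. Kishiba, Phys. Fluids 7 (1995) 411 (GGH's [Ohk1, Ohk2]; cited through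
  GGH97). [`OhkitaniKishiba1995`]
-/

noncomputable section

open Set Function Filter
open scoped RealInnerProductSpace Topology Laplacian

namespace Literature.Analysis.FluidPDE

namespace VortexStretchingDynamics

/-! ### Kinematics at a fixed time: the gradient of the stretching vector -/

section Kinematics

variable {u ω : EuclideanSpace ℝ (Fin 3) → EuclideanSpace ℝ (Fin 3)} {x : EuclideanSpace ℝ (Fin 3)}

/-- **`∇σ h = (∇²u h) ω + ∇u (∇ω h)`** for `σ(y) = ∇u(y) ω(y)`: the derivative of the stretching
vector field (product rule for the evaluation `(∇u(y))(ω(y))`), for `u` of class `C²` at `x` and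
`ω` differentiable at `x`. (GGH's (Aequn) with `A = u`, spatial part.)
[cite: GalantiGibbonHeritage1997, §1 (Aequn) (arXiv:chao-dyn/9709003 p. 3)] -/
theorem fderiv_stretching_apply (hu : ContDiffAt ℝ 2 u x) (hω : DifferentiableAt ℝ ω x)
    (h : EuclideanSpace ℝ (Fin 3)) :
    fderiv ℝ (fun y => fderiv ℝ u y (ω y)) x h =
      fderiv ℝ (fderiv ℝ u) x h (ω x) + fderiv ℝ u x (fderiv ℝ ω x h) := by
  have hA : DifferentiableAt ℝ (fderiv ℝ u) x :=
    (hu.fderiv_right (m := 1) (by norm_num)).differentiableAt (by simp)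
  rw [fderiv_clm_apply hA hω]
  simp only [add_apply, ContinuousLinearMap.comp_apply, ContinuousLinearMap.flip_apply]
  abel

/-- **`(u·∇)σ = ∇²u(ω)(u) + ∇u((u·∇)ω)`** — the convective derivative of the stretching vector,
with the second derivative SYMMETRISED (`∇²u(u)(ω) = ∇²u(ω)(u)`, Schwarz, `u ∈ C²` at `x`).
[cite: GalantiGibbonHeritage1997, §1 (Aequn)–(Aequn2) (arXiv:chao-dyn/9709003 p. 3)] -/
theorem convect_stretching_eq (hu : ContDiffAt ℝ 2 u x) (hω : DifferentiableAt ℝ ω x)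
    (a : EuclideanSpace ℝ (Fin 3)) :
    fderiv ℝ (fun y => fderiv ℝ u y (ω y)) x a =
      fderiv ℝ (fderiv ℝ u) x (ω x) a + fderiv ℝ u x (fderiv ℝ ω x a) := by
  have hsym : IsSymmSndFDerivAt ℝ u x :=
    hu.isSymmSndFDerivAt (by simp only [minSmoothness_of_isRCLikeNormedField]; exact le_rfl)
  rw [fderiv_stretching_apply hu hω a, hsym a (ω x)]

end Kinematics

/-! ### Dynamics: `Dσ/Dt` along Navier–Stokes / Euler -/

section Dynamics

variable {u : ℝ → EuclideanSpace ℝ (Fin 3) → EuclideanSpace ℝ (Fin 3)}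
  {p : ℝ → EuclideanSpace ℝ (Fin 3) → ℝ} {x : EuclideanSpace ℝ (Fin 3)} {t ν : ℝ}

/-- A jointly `C²` family has `C²` time slices. [folklore] -/
private theorem contDiffAt_slice (hu : ContDiffAt ℝ 2 (uncurry u) (t, x)) :
    ContDiffAt ℝ 2 (u t) x := by
  have h : ContDiffAt ℝ 2 (fun y : EuclideanSpace ℝ (Fin 3) => (t, y)) x :=
    contDiffAt_const.prodMk contDiffAt_id
  exact hu.comp x h

/-- `C²` functions have a differentiable gradient. [folklore] -/
private theorem differentiableAt_gradient {q : EuclideanSpace ℝ (Fin 3) → ℝ}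
    (hq : ContDiffAt ℝ 2 q x) : DifferentiableAt ℝ (gradient q) x := by
  have hfd : DifferentiableAt ℝ (fderiv ℝ q) x :=
    (hq.fderiv_right (m := 1) (by norm_num)).differentiableAt (by simp)
  have e : gradient q = fun y => (InnerProductSpace.toDual ℝ (EuclideanSpace ℝ (Fin 3))).symm
      (fderiv ℝ q y) := rfl
  rw [e]
  exact (InnerProductSpace.toDual ℝ (EuclideanSpace ℝ (Fin 3))).symm.toContinuousLinearEquiv
    |>.differentiableAt.comp x hfd

/-- `a × a = 0` for the tree's `cross`. [folklore] -/
private theorem cross_self_vsd (a : EuclideanSpace ℝ (Fin 3)) : cross a a = 0 := by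
  unfold cross
  rw [_root_.cross_self]
  rfl

/-- The core computation behind (sigderiv), with the viscous fields kept abstract: if
`∂ₜu = νL − (u·∇)u − ∇p` near `x` at time `t` and `∂ₜω = νM − (u·∇)ω + (ω·∇)u` at `(t, x)`, then
`∂ₜσ = ν(∇L ω + ∇u M) − (u·∇)σ − ∇²p ω`. [folklore] -/
private theorem hasDerivAt_stretching_core {L : EuclideanSpace ℝ (Fin 3) → EuclideanSpace ℝ (Fin 3)}
    {M : EuclideanSpace ℝ (Fin 3)} (hu : ContDiffAt ℝ 2 (uncurry u) (t, x))
    (hL : DifferentiableAt ℝ L x) (hp : ContDiffAt ℝ 2 (p t) x)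
    (hmom : ∀ᶠ y in 𝓝 x,
      deriv (fun s => u s y) t = ν • L y - convect (u t) (u t) y - gradient (p t) y)
    (hvort : HasDerivAt (fun s => curl (u s) x)
      (ν • M - convect (u t) (curl (u t)) x + convect (curl (u t)) (u t) x) t) :
    HasDerivAt (fun s => fderiv ℝ (u s) x (curl (u s) x))
      (ν • (fderiv ℝ L x (curl (u t) x) + fderiv ℝ (u t) x M) -
        fderiv ℝ (fun y => fderiv ℝ (u t) y (curl (u t) y)) x (u t x) -
        fderiv ℝ (gradient (p t)) x (curl (u t) x)) t := by
  have hut : ContDiffAt ℝ 2 (u t) x := contDiffAt_slice hu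
  have hA1 : DifferentiableAt ℝ (fderiv ℝ (u t)) x :=
    (hut.fderiv_right (m := 1) (by norm_num)).differentiableAt (by simp)
  have hud : DifferentiableAt ℝ (u t) x := hut.differentiableAt (by simp)
  have hωd : DifferentiableAt ℝ (curl (u t)) x := by
    rw [curl_eq_curlCLM_comp]
    exact curlCLM.differentiableAt.comp x hA1
  have hC : DifferentiableAt ℝ (fun y => fderiv ℝ (u t) y (u t y)) x := hA1.clm_apply hud
  have hP : DifferentiableAt ℝ (gradient (p t)) x := differentiableAt_gradient hp
  -- mixed partials: `∂ₜ ∇u = ∇ ∂ₜu`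
  obtain ⟨-, hA⟩ := hasDerivAt_fderiv_slice_of_contDiffAt hu
  -- `∇ ∂ₜu = ν ∇L − ∇((u·∇)u) − ∇²p` at `x`, from the momentum equation near `x`
  have hmom' : (fun y => deriv (fun s => u s y) t) =ᶠ[𝓝 x]
      fun y => ν • L y - fderiv ℝ (u t) y (u t y) - gradient (p t) y :=
    hmom.mono fun y hy => by
      show deriv (fun s => u s y) t = ν • L y - fderiv ℝ (u t) y (u t y) - gradient (p t) y
      rw [hy, convect_apply]
  have hF : HasFDerivAt (fun y => ν • L y - fderiv ℝ (u t) y (u t y) - gradient (p t) y)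
      (ν • fderiv ℝ L x - fderiv ℝ (fun y => fderiv ℝ (u t) y (u t y)) x -
        fderiv ℝ (gradient (p t)) x) x :=
    ((hL.hasFDerivAt.const_smul ν).sub hC.hasFDerivAt).sub hP.hasFDerivAt
  have hV : fderiv ℝ (fun y => deriv (fun s => u s y) t) x =
      ν • fderiv ℝ L x - fderiv ℝ (fun y => fderiv ℝ (u t) y (u t y)) x -
        fderiv ℝ (gradient (p t)) x := by
    rw [hmom'.fderiv_eq, hF.fderiv]
  -- product rule in time for `σ(s) = (∇u(s))(ω(s))`
  have hσ := hA.clm_apply hvort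
  refine hσ.congr_deriv ?_
  rw [hV]
  have e1 : fderiv ℝ (fun y => fderiv ℝ (u t) y (u t y)) x (curl (u t) x) =
      fderiv ℝ (fderiv ℝ (u t)) x (curl (u t) x) (u t x) +
        fderiv ℝ (u t) x (fderiv ℝ (u t) x (curl (u t) x)) :=
    fderiv_stretching_apply hut hud _
  have e2 : fderiv ℝ (fun y => fderiv ℝ (u t) y (curl (u t) y)) x (u t x) =
      fderiv ℝ (fderiv ℝ (u t)) x (curl (u t) x) (u t x) +
        fderiv ℝ (u t) x (fderiv ℝ (curl (u t)) x (u t x)) :=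
    convect_stretching_eq hut hωd _
  rw [e2, convect_apply, convect_apply]
  simp only [sub_apply, smul_apply, map_sub, map_add, map_smul, e1, smul_add]
  abel

/-- **Ohkitani's identity with viscosity (GGH97 (sigderiv), §3 form): `Dσ/Dt = −Pω + ν(∇Δu ω + ∇u Δω)`**,
`σ = ∇u ω = Sω`, `ω = curl u`, pointwise at `(t, x)`: if `uncurry u` is `C²` at `(t, x)`, `p(t,·)`
is `C²` at `x`, `Δu(t,·)` is differentiable at `x`, the momentum equation
`∂ₜu = νΔu − (u·∇)u − ∇p` holds near `x` at time `t`, and the classical vorticity equation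
`∂ₜω = νΔω − (u·∇)ω + (ω·∇)u` holds at `(t, x)`, then
`∂ₜσ = ν(∇(Δu) ω + ∇u (Δω)) − (u·∇)σ − (∇²p) ω` at `(t, x)`. In the derivation the two terms
`∇u(∇u ω)` (each `∼ ω|∇u|²`) cancel, exactly as printed, and `∇²u(ω)(u) = ∇²u(u)(ω)`.
[cite: GalantiGibbonHeritage1997, §1 (sigderiv) with (Aequn2), and §3 first displays (arXiv:chao-dyn/9709003 pp. 3, 7)] -/
theorem hasDerivAt_stretching (hu : ContDiffAt ℝ 2 (uncurry u) (t, x))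
    (hΔ : DifferentiableAt ℝ (Δ (u t)) x) (hp : ContDiffAt ℝ 2 (p t) x)
    (hmom : ∀ᶠ y in 𝓝 x,
      deriv (fun s => u s y) t = ν • Δ (u t) y - convect (u t) (u t) y - gradient (p t) y)
    (hvort : HasDerivAt (fun s => curl (u s) x)
      (ν • Δ (curl (u t)) x - convect (u t) (curl (u t)) x + convect (curl (u t)) (u t) x) t) :
    HasDerivAt (fun s => fderiv ℝ (u s) x (curl (u s) x))
      (ν • (fderiv ℝ (Δ (u t)) x (curl (u t) x) + fderiv ℝ (u t) x (Δ (curl (u t)) x)) -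
        fderiv ℝ (fun y => fderiv ℝ (u t) y (curl (u t) y)) x (u t x) -
        fderiv ℝ (gradient (p t)) x (curl (u t) x)) t :=
  hasDerivAt_stretching_core hu hΔ hp hmom hvort

/-- **GGH97 (sigderiv) / Ohkitani: `Dσ/Dt = −Pω` for Euler** (`σ = Sω = ∇u ω`): with `ν = 0`
in `hasDerivAt_stretching`, `∂ₜσ + (u·∇)σ = −(∇²p) ω` at `(t, x)`.
[cite: GalantiGibbonHeritage1997, §1 (sigderiv) (arXiv:chao-dyn/9709003 p. 3)] -/
theorem hasDerivAt_stretching_euler (hu : ContDiffAt ℝ 2 (uncurry u) (t, x))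
    (hp : ContDiffAt ℝ 2 (p t) x)
    (hmom : ∀ᶠ y in 𝓝 x, deriv (fun s => u s y) t = -convect (u t) (u t) y - gradient (p t) y)
    (hvort : HasDerivAt (fun s => curl (u s) x)
      (-convect (u t) (curl (u t)) x + convect (curl (u t)) (u t) x) t) :
    HasDerivAt (fun s => fderiv ℝ (u s) x (curl (u s) x))
      (-fderiv ℝ (fun y => fderiv ℝ (u t) y (curl (u t) y)) x (u t x) -
        fderiv ℝ (gradient (p t)) x (curl (u t) x)) t := by
  have hmom' : ∀ᶠ y in 𝓝 x, deriv (fun s => u s y) t =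
      (0 : ℝ) • (0 : EuclideanSpace ℝ (Fin 3)) - convect (u t) (u t) y - gradient (p t) y :=
    hmom.mono fun y hy => by rw [hy, smul_zero, zero_sub]
  have hvort' : HasDerivAt (fun s => curl (u s) x)
      ((0 : ℝ) • (0 : EuclideanSpace ℝ (Fin 3)) - convect (u t) (curl (u t)) x +
        convect (curl (u t)) (u t) x) t := by
    rwa [smul_zero, zero_sub]
  have h := hasDerivAt_stretching_core (L := fun _ => 0) hu (differentiableAt_const _) hp hmom' hvort'
  refine h.congr_deriv ?_
  rw [zero_smul, zero_sub]

/-- **GGH97 (conv2) with viscosity: `D(ω × σ)/Dt = −ω × Pω + ν(Δω × σ + ω × (∇Δu ω + ∇u Δω))`**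
(`σ = ∇u ω`; "in the cross product, the terms in `σ` vanish", `σ × σ = 0`), pointwise at `(t, x)`
under the hypotheses of `hasDerivAt_stretching`; the convective part of `D/Dt` is
`fderiv ℝ (y ↦ ω(y) × σ(y)) x (u x)`.
[cite: GalantiGibbonHeritage1997, §2 (conv2) (arXiv:chao-dyn/9709003 p. 5)] -/
theorem hasDerivAt_cross_stretching (hu : ContDiffAt ℝ 2 (uncurry u) (t, x))
    (hΔ : DifferentiableAt ℝ (Δ (u t)) x) (hp : ContDiffAt ℝ 2 (p t) x)
    (hmom : ∀ᶠ y in 𝓝 x,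
      deriv (fun s => u s y) t = ν • Δ (u t) y - convect (u t) (u t) y - gradient (p t) y)
    (hvort : HasDerivAt (fun s => curl (u s) x)
      (ν • Δ (curl (u t)) x - convect (u t) (curl (u t)) x + convect (curl (u t)) (u t) x) t) :
    HasDerivAt (fun s => cross (curl (u s) x) (fderiv ℝ (u s) x (curl (u s) x)))
      (ν • (cross (Δ (curl (u t)) x) (fderiv ℝ (u t) x (curl (u t) x)) +
          cross (curl (u t) x)
            (fderiv ℝ (Δ (u t)) x (curl (u t) x) + fderiv ℝ (u t) x (Δ (curl (u t)) x))) -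
        fderiv ℝ (fun y => cross (curl (u t) y) (fderiv ℝ (u t) y (curl (u t) y))) x (u t x) -
        cross (curl (u t) x) (fderiv ℝ (gradient (p t)) x (curl (u t) x))) t := by
  have hut : ContDiffAt ℝ 2 (u t) x := contDiffAt_slice hu
  have hA1 : DifferentiableAt ℝ (fderiv ℝ (u t)) x :=
    (hut.fderiv_right (m := 1) (by norm_num)).differentiableAt (by simp)
  have hωd : DifferentiableAt ℝ (curl (u t)) x := by
    rw [curl_eq_curlCLM_comp]
    exact curlCLM.differentiableAt.comp x hA1
  have hσd : DifferentiableAt ℝ (fun y => fderiv ℝ (u t) y (curl (u t) y)) x := hA1.clm_apply hωd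
  have hσ := hasDerivAt_stretching hu hΔ hp hmom hvort
  have h := ContinuousLinearMap.hasDerivAt_of_bilinear (B := crossCLM) (fun _ => hvort) (fun _ => hσ)
  simp only [crossCLM_apply] at h
  refine h.congr_deriv ?_
  have e3 : fderiv ℝ (fun y => cross (curl (u t) y) (fderiv ℝ (u t) y (curl (u t) y))) x (u t x) =
      cross (curl (u t) x) (fderiv ℝ (fun y => fderiv ℝ (u t) y (curl (u t) y)) x (u t x)) +
        cross (fderiv ℝ (curl (u t)) x (u t x)) (fderiv ℝ (u t) x (curl (u t) x)) := by
    rw [(hasFDerivAt_cross hωd.hasFDerivAt hσd.hasFDerivAt).fderiv]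
    simp only [add_apply, ContinuousLinearMap.precompR_apply, ContinuousLinearMap.compL_apply,
      ContinuousLinearMap.coe_comp, Function.comp_apply, ContinuousLinearMap.precompL_apply,
      crossCLM_apply]
  rw [e3, convect_apply, convect_apply]
  simp only [← crossCLM_apply, map_sub, map_add, map_smul, sub_apply, add_apply, smul_apply,
    smul_add]
  have h0 : crossCLM (fderiv ℝ (u t) x (curl (u t) x)) (fderiv ℝ (u t) x (curl (u t) x)) = 0 := by
    rw [crossCLM_apply, cross_self_vsd]
  rw [h0]
  abel

/-- **GGH97 (conv2) for Euler: `D(ω × σ)/Dt = −ω × Pω`**, i.e.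
`∂ₜ(ω × σ) + (u·∇)(ω × σ) = −ω × (∇²p) ω` at `(t, x)`.
[cite: GalantiGibbonHeritage1997, §2 (conv2) (arXiv:chao-dyn/9709003 p. 5)] -/
theorem hasDerivAt_cross_stretching_euler (hu : ContDiffAt ℝ 2 (uncurry u) (t, x))
    (hp : ContDiffAt ℝ 2 (p t) x)
    (hmom : ∀ᶠ y in 𝓝 x, deriv (fun s => u s y) t = -convect (u t) (u t) y - gradient (p t) y)
    (hvort : HasDerivAt (fun s => curl (u s) x)
      (-convect (u t) (curl (u t)) x + convect (curl (u t)) (u t) x) t) :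
    HasDerivAt (fun s => cross (curl (u s) x) (fderiv ℝ (u s) x (curl (u s) x)))
      (-fderiv ℝ (fun y => cross (curl (u t) y) (fderiv ℝ (u t) y (curl (u t) y))) x (u t x) -
        cross (curl (u t) x) (fderiv ℝ (gradient (p t)) x (curl (u t) x))) t := by
  have hut : ContDiffAt ℝ 2 (u t) x := contDiffAt_slice hu
  have hA1 : DifferentiableAt ℝ (fderiv ℝ (u t)) x :=
    (hut.fderiv_right (m := 1) (by norm_num)).differentiableAt (by simp)
  have hωd : DifferentiableAt ℝ (curl (u t)) x := by
    rw [curl_eq_curlCLM_comp]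
    exact curlCLM.differentiableAt.comp x hA1
  have hσd : DifferentiableAt ℝ (fun y => fderiv ℝ (u t) y (curl (u t) y)) x := hA1.clm_apply hωd
  have hσ := hasDerivAt_stretching_euler hu hp hmom hvort
  have h := ContinuousLinearMap.hasDerivAt_of_bilinear (B := crossCLM) (fun _ => hvort) (fun _ => hσ)
  simp only [crossCLM_apply] at h
  refine h.congr_deriv ?_
  have e3 : fderiv ℝ (fun y => cross (curl (u t) y) (fderiv ℝ (u t) y (curl (u t) y))) x (u t x) =
      cross (curl (u t) x) (fderiv ℝ (fun y => fderiv ℝ (u t) y (curl (u t) y)) x (u t x)) +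
        cross (fderiv ℝ (curl (u t)) x (u t x)) (fderiv ℝ (u t) x (curl (u t) x)) := by
    rw [(hasFDerivAt_cross hωd.hasFDerivAt hσd.hasFDerivAt).fderiv]
    simp only [add_apply, ContinuousLinearMap.precompR_apply, ContinuousLinearMap.compL_apply,
      ContinuousLinearMap.coe_comp, Function.comp_apply, ContinuousLinearMap.precompL_apply,
      crossCLM_apply]
  rw [e3, convect_apply, convect_apply]
  simp only [← crossCLM_apply, map_sub, map_add, map_neg, add_apply, neg_apply]
  have h0 : crossCLM (fderiv ℝ (u t) x (curl (u t) x)) (fderiv ℝ (u t) x (curl (u t) x)) = 0 := by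
    rw [crossCLM_apply, cross_self_vsd]
  rw [h0]
  abel

/-! ### The `α`-axis remark: persistent alignment forces alignment with the pressure Hessian -/

/-- **"On the `α`-axis … `ω × Pω = 0`" with viscosity**: if the tilting vector `ω × ∇u ω`
vanishes on a space–time neighbourhood of `(t, x)` (persistent exact alignment of `ω` with an
eigenvector of the strain), then at `(t, x)` the pressure-Hessian tilting is carried by the viscous
terms alone: `ω × (∇²p) ω = ν(Δω × σ + ω × (∇Δu ω + ∇u Δω))`.
[cite: GalantiGibbonHeritage1997, §2 remark after (chipdef) and §6 p. 11 (arXiv:chao-dyn/9709003 pp. 5, 11)] -/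
theorem cross_pressureHessian_eq_of_tiltingFree (hu : ContDiffAt ℝ 2 (uncurry u) (t, x))
    (hΔ : DifferentiableAt ℝ (Δ (u t)) x) (hp : ContDiffAt ℝ 2 (p t) x)
    (hmom : ∀ᶠ y in 𝓝 x,
      deriv (fun s => u s y) t = ν • Δ (u t) y - convect (u t) (u t) y - gradient (p t) y)
    (hvort : HasDerivAt (fun s => curl (u s) x)
      (ν • Δ (curl (u t)) x - convect (u t) (curl (u t)) x + convect (curl (u t)) (u t) x) t)
    (htf : ∀ᶠ z in 𝓝 (t, x),
      cross (curl (u z.1) z.2) (fderiv ℝ (u z.1) z.2 (curl (u z.1) z.2)) = 0) :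
    cross (curl (u t) x) (fderiv ℝ (gradient (p t)) x (curl (u t) x)) =
      ν • (cross (Δ (curl (u t)) x) (fderiv ℝ (u t) x (curl (u t) x)) +
        cross (curl (u t) x)
          (fderiv ℝ (Δ (u t)) x (curl (u t) x) + fderiv ℝ (u t) x (Δ (curl (u t)) x))) := by
  have h := hasDerivAt_cross_stretching hu hΔ hp hmom hvort
  -- along the time line through `x` the tilting vanishes identically near `t`
  have hline_t : Tendsto (fun s : ℝ => (s, x)) (𝓝 t) (𝓝 (t, x)) :=
    (continuous_id.prodMk continuous_const).tendsto t
  have ht0 : (fun s => cross (curl (u s) x) (fderiv ℝ (u s) x (curl (u s) x))) =ᶠ[𝓝 t]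
      fun _ => (0 : EuclideanSpace ℝ (Fin 3)) :=
    hline_t.eventually htf
  have hd0 : HasDerivAt (fun s => cross (curl (u s) x) (fderiv ℝ (u s) x (curl (u s) x))) 0 t :=
    (hasDerivAt_const t (0 : EuclideanSpace ℝ (Fin 3))).congr_of_eventuallyEq ht0
  -- along the space slice through `t` it vanishes identically near `x`
  have hline_x : Tendsto (fun y : EuclideanSpace ℝ (Fin 3) => (t, y)) (𝓝 x) (𝓝 (t, x)) :=
    (continuous_const.prodMk continuous_id).tendsto x
  have hx0 : (fun y => cross (curl (u t) y) (fderiv ℝ (u t) y (curl (u t) y))) =ᶠ[𝓝 x]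
      fun _ => (0 : EuclideanSpace ℝ (Fin 3)) :=
    hline_x.eventually htf
  have hfd : fderiv ℝ (fun y => cross (curl (u t) y) (fderiv ℝ (u t) y (curl (u t) y))) x = 0 := by
    rw [hx0.fderiv_eq, fderiv_const_apply]
  have huniq := h.unique hd0
  rw [hfd, zero_apply, sub_zero, sub_eq_zero] at huniq
  exact huniq.symm

/-- **GGH97's double alignment for Euler**: if `ω × Sω` vanishes on a space–time neighbourhood of
`(t, x)` then **`ω × Pω = 0`** at `(t, x)` — "when `ω` aligns with an eigenvector of `S` then `ω`
also aligns simultaneously with an eigenvector of `P`".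
[cite: GalantiGibbonHeritage1997, §2 remark after (chipdef) («On the α-axis … ω × Pω = 0») and §6 p. 11 (arXiv:chao-dyn/9709003 pp. 5, 11)] -/
theorem cross_pressureHessian_eq_zero_of_tiltingFree_euler (hu : ContDiffAt ℝ 2 (uncurry u) (t, x))
    (hp : ContDiffAt ℝ 2 (p t) x)
    (hmom : ∀ᶠ y in 𝓝 x, deriv (fun s => u s y) t = -convect (u t) (u t) y - gradient (p t) y)
    (hvort : HasDerivAt (fun s => curl (u s) x)
      (-convect (u t) (curl (u t)) x + convect (curl (u t)) (u t) x) t)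
    (htf : ∀ᶠ z in 𝓝 (t, x),
      cross (curl (u z.1) z.2) (fderiv ℝ (u z.1) z.2 (curl (u z.1) z.2)) = 0) :
    cross (curl (u t) x) (fderiv ℝ (gradient (p t)) x (curl (u t) x)) = 0 := by
  have h := hasDerivAt_cross_stretching_euler hu hp hmom hvort
  have hline_t : Tendsto (fun s : ℝ => (s, x)) (𝓝 t) (𝓝 (t, x)) :=
    (continuous_id.prodMk continuous_const).tendsto t
  have ht0 : (fun s => cross (curl (u s) x) (fderiv ℝ (u s) x (curl (u s) x))) =ᶠ[𝓝 t]
      fun _ => (0 : EuclideanSpace ℝ (Fin 3)) :=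
    hline_t.eventually htf
  have hd0 : HasDerivAt (fun s => cross (curl (u s) x) (fderiv ℝ (u s) x (curl (u s) x))) 0 t :=
    (hasDerivAt_const t (0 : EuclideanSpace ℝ (Fin 3))).congr_of_eventuallyEq ht0
  have hline_x : Tendsto (fun y : EuclideanSpace ℝ (Fin 3) => (t, y)) (𝓝 x) (𝓝 (t, x)) :=
    (continuous_const.prodMk continuous_id).tendsto x
  have hx0 : (fun y => cross (curl (u t) y) (fderiv ℝ (u t) y (curl (u t) y))) =ᶠ[𝓝 x]
      fun _ => (0 : EuclideanSpace ℝ (Fin 3)) :=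
    hline_x.eventually htf
  have hfd : fderiv ℝ (fun y => cross (curl (u t) y) (fderiv ℝ (u t) y (curl (u t) y))) x = 0 := by
    rw [hx0.fderiv_eq, fderiv_const_apply]
  have huniq := h.unique hd0
  rw [hfd, zero_apply, neg_zero, zero_sub, neg_eq_zero] at huniq
  exact huniq

end Dynamics

end VortexStretchingDynamics

end Literature.Analysis.FluidPDE
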